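import Literature.MathematicalPhysics.QuantumFieldTheory.Balaban1983to89.B13Bound226From216
import Literature.MathematicalPhysics.QuantumFieldTheory.Dimock2015.AnalyticLipschitz

/-!
# `Balaban1983to89.B13Eq216AnalyticStep` — T. Bałaban, *Renormalization group approach to lattice gauge field theories.
II. Cluster expansions*, Commun. Math. Phys. **116** (1988) 1–22 [Balaban1988RG2Cluster], pp. 15–16: the ANALYTICITY
STEP behind the `O(α₀ + α₁)` term of the leaf (2.16) — an operator that is an analytic function of the configuration
`(𝐔, 𝐉)` on the BIGGER space (p. 15: *"analytic functions on the space of configurations (U, J) satisfying the conditions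
I.(i)–(iii) on the domain Z, with constants α′₀, α′₁ much bigger than α₀, α₁"*) with a kernel uniformly localised
there differs at a small configuration (`|A″|, |∇A′| < α₁, |𝐉| < α₀`) from its value at `(U, 0)` by a kernel obeying
the printed entrywise shape (2.16) with constant `2θ₀·α/R` — the Schwarz lemma for maps between complex normed spaces
(Mathlib `Complex.dist_le_div_mul_dist_of_mapsTo_ball`, in the tree as `Dimock2015.AnalyticLipschitz.norm_sub_centre_le`),
entry by entry.  The parameter space is any complex normed space, so the same statement covers the σ-polydisc (a ball of
`ι → ℂ` in the sup norm); the printed σ-part `O(1)e^{−⅓δ₀M}` of (2.16), however, comes from the random-walk expansions of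
[13]/[15] and is NOT produced by this step — it enters the two-part split `h216_split` as a hypothesis.

statement-level skeleton of published theorems with citation tags; proofs where landed; nothing here is a claim about
the Yang–Mills mass gap

PDF held: `paper:balaban1988-cmp116-rg-ii-cluster` (journal page = PDF page + 0); pp. 15–16 re-read this session
(materialised `p0015.txt`/`p0016.txt`, render `pub-balaban/b2b-balaban-ref1/pages/1988-cmp116-rg-II-cluster/…-p016-x2.png`,
cell transcript `pub-balaban/b2b-balaban-b13/transcript-B13.md` ll. 145–152, locus L16a).

CITATION HEADER (verbatim, p. 15 [PDF 15] and p. 16 [PDF 16]): *"The quadratic forms and covariances in H(Z) are analytic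
functions on the space of configurations (U, J) satisfying the conditions I.(i)–(iii) on the domain Z, with constants
α′₀, α′₁ much bigger than α₀, α₁, therefore we can restrict them, as analytic functions, to the above subspace. … We use
the fact that, by the definition of the space, the configuration 𝐔 can be written as 𝐔 = U′U, U′ = exp iL⁻¹ηA′, and
A′, 𝐉 have values in 𝔤ᶜ, but they are small. More precisely we have |A″|, |∇_U^{L⁻¹η}A′| < α₁, |𝐉| < α₀. For the pair
(U, 0) the operators are symmetric, and the measure is positive, and then the estimates are simpler. The general case is
handled by a perturbative argument. … In the expression on the right-hand side we replace the operators by the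
corresponding operators with σ(Z) = 0, 𝐔 = U, 𝐉 = 0, and we estimate the error. For the quadratic form in the first
exponential the difference is a quadratic form ½⟨X, R₁X⟩, with matrix elements satisfying the bound*
`|R₁(b, b′)| ≦ (O(1)e^{−⅓δ₀M} + O(α₀ + α₁)) exp(−½δ₀|b₋ − b′₋|).`  (2.16)"

WHAT IS REPRODUCED (unit `lit-balaban-r10` gen 11, B13 fold owner; SKELETON row `B13.Eq2.16` of
`HOME/lit-balaban-r10/ROWS-B13.md` — head «typed-existing (hyp shape) · absent (derivation)»; the cell's GAPS loci
G-B13-05a / G-IF-10 name exactly «analyticity + uniform localisation» as what the leaf rests on).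
* §1 `norm_sub_apply_zero_le_of_norm_le` — the Schwarz step for `f : E → F` between complex normed spaces at a small
  parameter: analytic on the ball `‖x‖ < R` with `‖f‖ ≤ M` there and `‖x‖ ≤ α < R` ⇒ `‖f x − f 0‖ ≤ (2M/R)·α`.  The
  step itself, `‖f x − f c‖ ≤ (2M/R)‖x − c‖`, is the tree's `Dimock2015.AnalyticLipschitz.norm_sub_centre_le` (REUSED,
  not restated; its scalar-parameter form is `B13PerturbativeStep.norm_sub_apply_zero_le`).
* §2 `entry_sub_le_of_differentiableOn` — a (rectangular) kernel family `u ↦ K u`, entrywise analytic on the ball of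
  radius `R` of the parameter space and dominated there by ONE localised majorant `θ₀·g(i,j)`, has
  `‖(K u − K 0)(i,j)‖ ≤ (2θ₀/R)‖u‖·g(i,j)`; `h216_of_differentiableOn` — with `g = e^{−κ|loc i − loc j|₁}` (bonds located
  on ℤ^ν) and `‖u‖ ≤ α < R`: the printed entrywise shape (2.16) with constant `2θ₀α/R` = the `O(α₀ + α₁)` term;
  `h216_re_of_differentiableOn` — the same for the real part (the shape of `R₃ = Re Γ(σ, 𝐔, 𝐉) − Γ₀`).
* §3 `h216_split` — THE TWO-PART CONSTANT of (2.16): for a family `A(σ, u)` with `A(0, 0)` the `σ = 0`, `(U, 0)` value,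
  IF the σ-part `A(σ, 0) − A(0, 0)` obeys the entrywise (2.16) with `θ_σ` (print: `O(1)e^{−⅓δ₀M}`; cross-paper, a
  hypothesis) and `A(σ, ·)` is entrywise analytic on the `R`-ball with the uniform localised majorant `θ₀e^{−κ|·|}`, THEN
  at `‖u‖ ≤ α < R` the full difference obeys (2.16) with `θ_σ + 2θ₀α/R`; `h216E_of_analytic` / `h216R3_of_analytic` —
  the hypotheses `h216E` / `h216R3` of `B13Bound226From216.norm_term214_le_226_of_216` in exactly their shape, uniformly
  on the σ-polydisc.
HONEST SCOPE.  The analytic MECHANISM of the `O(α₀ + α₁)` term only (Schwarz lemma + uniform localisation), for kernels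
on abstract located index sets; that the actual operators `C^{(k)}(Z₀, σ)⁻¹`, `Γ_k(Z₀, σ)` of [13]/[15] are analytic in
(𝐔, 𝐉) on the bigger space with uniformly localised random-walk expansions, and the σ-part `O(1)e^{−⅓δ₀M}`, remain the
cross-paper inputs (L16a/L17a); the composite `R₁` (first quadratic form) is not treated here.  No `sorry`, no
definition, no new named fact (D-0026).
-/

noncomputable section

namespace Literature.MathematicalPhysics.QuantumFieldTheory.Balaban1983to89.B13Eq216AnalyticStep

open Metric Set Matrix
open B2Lemma25Proof (l1dist l1dist_nonneg)
open Dimock2015 (norm_sub_centre_le)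

/-! ## §1. The Schwarz step for a Banach parameter -/

section Schwarz

variable {E F : Type*} [NormedAddCommGroup E] [NormedSpace ℂ E] [NormedAddCommGroup F] [NormedSpace ℂ F]

/-- **The Schwarz step at a small parameter**: a map `f : E → F` between complex normed spaces, complex analytic on the
ball `‖x‖ < R` and bounded there by `M`, satisfies `‖f x − f 0‖ ≤ (2M/R)·α` whenever `‖x‖ ≤ α < R` — in print the
analyticity radius is the «much bigger» `α′`, the configuration has size `< α`, and the difference is `O(α)` with the
constant `2M/α′`.  The step `‖f x − f 0‖ ≤ (2M/R)‖x‖` is `Dimock2015.AnalyticLipschitz.norm_sub_centre_le` (Schwarz lemma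
for `f − f 0`). [folklore] [cite: Balaban1988RG2Cluster, (2.16) p.16 (mechanism of the O(α₀ + α₁) term), p.15 (analyticity on the bigger space)] -/
theorem norm_sub_apply_zero_le_of_norm_le {f : E → F} {R M α : ℝ} (hαR : α < R)
    (hf : DifferentiableOn ℂ f (ball 0 R)) (hM : ∀ x ∈ ball (0 : E) R, ‖f x‖ ≤ M) {x : E} (hx : ‖x‖ ≤ α) :
    ‖f x - f 0‖ ≤ 2 * M / R * α := by
  have hxR : x ∈ ball (0 : E) R := by rw [mem_ball, dist_zero_right]; exact hx.trans_lt hαR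
  have hR : 0 < R := (norm_nonneg x).trans hx |>.trans_lt hαR
  have hM0 : 0 ≤ M := (norm_nonneg _).trans (hM 0 (mem_ball_self hR))
  have h := norm_sub_centre_le hf hM hxR
  rw [sub_zero] at h
  exact h.trans (mul_le_mul_of_nonneg_left hx (by positivity))

end Schwarz

/-! ## §2. Entrywise: a uniformly localised analytic kernel family moves by `O(‖u‖/R)` in the shape (2.16) -/

section Kernels

variable {E : Type*} [NormedAddCommGroup E] [NormedSpace ℂ E] {ν : ℕ} {p n : Type*}

/-- **The entrywise analyticity step**: a (rectangular) complex kernel family `u ↦ K u` whose entries are complex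
analytic on the ball `‖u‖ < R` of the parameter space and are dominated there by ONE localised majorant,
`‖K u (i,j)‖ ≤ θ₀·g(i,j)` (`g ≥ 0`), satisfies `‖(K u − K 0)(i,j)‖ ≤ (2θ₀/R)·‖u‖·g(i,j)` on that ball — the localisation
is inherited by the difference, with a constant linear in the size of the parameter. [cite: Balaban1988RG2Cluster, (2.16) p.16, p.15] -/
theorem entry_sub_le_of_differentiableOn {K : E → Matrix p n ℂ} {R θ₀ : ℝ} (hR : 0 < R) {g : p → n → ℝ}
    (hg : ∀ i j, 0 ≤ g i j) (ha : ∀ i j, DifferentiableOn ℂ (fun u => K u i j) (ball 0 R))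
    (hm : ∀ u ∈ ball (0 : E) R, ∀ i j, ‖K u i j‖ ≤ θ₀ * g i j) {u : E} (hu : u ∈ ball (0 : E) R) (i : p) (j : n) :
    ‖(K u - K 0) i j‖ ≤ 2 * θ₀ / R * ‖u‖ * g i j := by
  have h := norm_sub_centre_le (ha i j) (fun w hw => hm w hw i j) hu
  rw [sub_zero] at h
  rw [Matrix.sub_apply]
  refine h.trans (le_of_eq ?_)
  have := hg i j
  field_simp

/-- **The `O(α₀ + α₁)` term of (2.16)**: with the located-bond weight `g(i,j) = e^{−κ|loc′ i − loc j|₁}` and a parameter of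
size `‖u‖ ≤ α < R` (`R` = the analyticity radius on the bigger space), the difference kernel obeys the printed entrywise
shape (2.16) with constant `2θ₀α/R`: `‖(K u − K 0)(b,b′)‖ ≤ (2θ₀α/R)·e^{−κ|b₋ − b′₋|₁}`.
[cite: Balaban1988RG2Cluster, (2.16) p.16, p.15] -/
theorem h216_of_differentiableOn {K : E → Matrix p n ℂ} {R θ₀ α κ : ℝ} (hR : 0 < R) (hθ₀ : 0 ≤ θ₀) (hαR : α < R)
    (locp : p → (Fin ν → ℤ)) (locn : n → (Fin ν → ℤ))
    (ha : ∀ i j, DifferentiableOn ℂ (fun u => K u i j) (ball 0 R))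
    (hm : ∀ u ∈ ball (0 : E) R, ∀ i j, ‖K u i j‖ ≤ θ₀ * Real.exp (-(κ * l1dist (locp i) (locn j))))
    {u : E} (hu : ‖u‖ ≤ α) (i : p) (j : n) :
    ‖(K u - K 0) i j‖ ≤ 2 * θ₀ * α / R * Real.exp (-(κ * l1dist (locp i) (locn j))) := by
  have huR : u ∈ ball (0 : E) R := by rw [mem_ball, dist_zero_right]; exact hu.trans_lt hαR
  have h := entry_sub_le_of_differentiableOn hR (fun i j => (Real.exp_pos _).le) ha hm huR i j
  refine h.trans ?_
  have hexp : 0 ≤ Real.exp (-(κ * l1dist (locp i) (locn j))) := (Real.exp_pos _).le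
  have h1 : 2 * θ₀ / R * ‖u‖ ≤ 2 * θ₀ * α / R :=
    (mul_le_mul_of_nonneg_left hu (by positivity : (0 : ℝ) ≤ 2 * θ₀ / R)).trans_eq (by ring)
  exact mul_le_mul_of_nonneg_right h1 hexp

/-- **The same for the real part** (the shape of `R₃ = Re Γ_k(Z₀, σ, 𝐔, 𝐉) − Γ_k(Z₀, 0, U, 0)` when the reference value is
real): `‖Re (K u − K 0)(b,b′)‖ ≤ (2θ₀α/R)·e^{−κ|b₋ − b′₋|₁}`. [cite: Balaban1988RG2Cluster, (2.16) p.16] -/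
theorem h216_re_of_differentiableOn {K : E → Matrix p n ℂ} {R θ₀ α κ : ℝ} (hR : 0 < R) (hθ₀ : 0 ≤ θ₀) (hαR : α < R)
    (locp : p → (Fin ν → ℤ)) (locn : n → (Fin ν → ℤ))
    (ha : ∀ i j, DifferentiableOn ℂ (fun u => K u i j) (ball 0 R))
    (hm : ∀ u ∈ ball (0 : E) R, ∀ i j, ‖K u i j‖ ≤ θ₀ * Real.exp (-(κ * l1dist (locp i) (locn j))))
    {u : E} (hu : ‖u‖ ≤ α) (i : p) (j : n) :
    ‖((K u - K 0).map Complex.re) i j‖ ≤ 2 * θ₀ * α / R * Real.exp (-(κ * l1dist (locp i) (locn j))) := by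
  rw [Matrix.map_apply, Real.norm_eq_abs]
  exact (Complex.abs_re_le_norm _).trans (h216_of_differentiableOn hR hθ₀ hαR locp locn ha hm hu i j)

end Kernels

/-! ## §3. The two-part constant «O(1)e^{−⅓δ₀M} + O(α₀ + α₁)» and the hypotheses of `B13Bound226From216` -/

section Split

variable {E : Type*} [NormedAddCommGroup E] [NormedSpace ℂ E] {ν : ℕ} {p n : Type*} {ι : Type*}

/-- **The two-part constant of (2.16).**  Let `A(σ, u)` be a kernel family in the interpolation parameters `σ` and the
configuration parameter `u` (= `(A′, A″, 𝐉)`, a point of a complex normed space), `A(0, 0)` its `σ = 0`, `(U, 0)`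
value.  IF the σ-part `A(σ, 0) − A(0, 0)` obeys the entrywise (2.16) with constant `θ_σ` (print: `O(1)e^{−⅓δ₀M}` — from the
random-walk expansions, a hypothesis here), and for this `σ` the map `u ↦ A(σ, u)` is entrywise analytic on the ball
`‖u‖ < R` with the uniform localised majorant `θ₀e^{−κ|b₋−b′₋|₁}`, THEN at every `‖u‖ ≤ α < R` the full difference
`A(σ, u) − A(0, 0)` obeys (2.16) with constant `θ_σ + 2θ₀α/R` — the printed `O(1)e^{−⅓δ₀M} + O(α₀ + α₁)`.
[cite: Balaban1988RG2Cluster, (2.16) p.16, p.15] -/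
theorem h216_split {A : ι → E → Matrix p n ℂ} (σ σ0 : ι) {R θ₀ θσ α κ : ℝ} (hR : 0 < R) (hθ₀ : 0 ≤ θ₀)
    (hαR : α < R) (locp : p → (Fin ν → ℤ)) (locn : n → (Fin ν → ℤ))
    (hσpart : ∀ i j, ‖(A σ 0 - A σ0 0) i j‖ ≤ θσ * Real.exp (-(κ * l1dist (locp i) (locn j))))
    (ha : ∀ i j, DifferentiableOn ℂ (fun u => A σ u i j) (ball 0 R))
    (hm : ∀ u ∈ ball (0 : E) R, ∀ i j, ‖A σ u i j‖ ≤ θ₀ * Real.exp (-(κ * l1dist (locp i) (locn j))))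
    {u : E} (hu : ‖u‖ ≤ α) (i : p) (j : n) :
    ‖(A σ u - A σ0 0) i j‖ ≤ (θσ + 2 * θ₀ * α / R) * Real.exp (-(κ * l1dist (locp i) (locn j))) := by
  have h1 := h216_of_differentiableOn hR hθ₀ hαR locp locn ha hm hu i j
  have h2 := hσpart i j
  have hsplit : (A σ u - A σ0 0) i j = (A σ u - A σ 0) i j + (A σ 0 - A σ0 0) i j := by
    simp only [Matrix.sub_apply]; ring
  rw [hsplit, add_mul, add_comm (θσ * _)]
  exact (norm_add_le _ _).trans (add_le_add h1 h2)

variable {Λ : Type} [Fintype Λ] [DecidableEq Λ] {C₀ : Type}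

/-- **The hypothesis `h216E` of `B13Bound226From216.norm_term214_le_226_of_216` from analyticity in (𝐔, 𝐉)**: for the
precision family `A(σ, u)` (square, bonds of `Z₀`) with `A(0, 0) = C⁻¹` real (*"For the pair (U, 0) the operators are
symmetric, and the measure is positive"*), the σ-part entrywise bound `θ_σ` on the σ-polydisc (hypothesis) and entrywise
analyticity in `u` on the `R`-ball with the uniform localised majorant `θ₀` (uniformly on the σ-polydisc) give, at the
actual configuration `u` of size `≤ α < R`: `‖(A(σ, u) − C⁻¹)(b,b′)‖ ≤ (θ_σ + 2θ₀α/R)·e^{−κ|b₋−b′₋|₁}` for every `σ` of the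
polydisc — `E(σ) = A(σ) − C⁻¹` obeys the printed (2.16). [cite: Balaban1988RG2Cluster, (2.16) p.16, p.15] -/
theorem h216E_of_analytic {A : (ι → ℂ) → E → Matrix Λ Λ ℂ} {C : Matrix Λ Λ ℝ} (Rσ : ι → ℝ) {R θ₀ θσ α κ : ℝ}
    (hR : 0 < R) (hθ₀ : 0 ≤ θ₀) (hαR : α < R) (loc : Λ → (Fin ν → ℤ))
    (hA0 : A 0 0 = C⁻¹.map (algebraMap ℝ ℂ))
    (hσpart : ∀ σ : ι → ℂ, (∀ j, ‖σ j‖ ≤ Rσ j) →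
      ∀ b b', ‖(A σ 0 - A 0 0) b b'‖ ≤ θσ * Real.exp (-(κ * l1dist (loc b) (loc b'))))
    (ha : ∀ σ : ι → ℂ, (∀ j, ‖σ j‖ ≤ Rσ j) → ∀ b b', DifferentiableOn ℂ (fun u => A σ u b b') (ball 0 R))
    (hm : ∀ σ : ι → ℂ, (∀ j, ‖σ j‖ ≤ Rσ j) →
      ∀ u ∈ ball (0 : E) R, ∀ b b', ‖A σ u b b'‖ ≤ θ₀ * Real.exp (-(κ * l1dist (loc b) (loc b'))))
    {u : E} (hu : ‖u‖ ≤ α) :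
    ∀ σ : ι → ℂ, (∀ j, ‖σ j‖ ≤ Rσ j) →
      ∀ b b', ‖(A σ u - C⁻¹.map (algebraMap ℝ ℂ)) b b'‖
        ≤ (θσ + 2 * θ₀ * α / R) * Real.exp (-(κ * l1dist (loc b) (loc b'))) := fun σ hσ b b' => by
  rw [← hA0]
  exact h216_split (A := A) σ 0 hR hθ₀ hαR loc loc (hσpart σ hσ) (ha σ hσ) (hm σ hσ) hu b b'

omit [Fintype Λ] [DecidableEq Λ] in
/-- **The hypothesis `h216R3` of `B13Bound226From216.norm_term214_le_226_of_216` from analyticity in (𝐔, 𝐉)**: for a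
RECTANGULAR kernel family `G(σ, u)` (bonds of `Z₀` × bonds of `Z`; the matrix of `X ↦ Γ_k(Z₀, σ, 𝐔, 𝐉)X`) with
`G(0, 0) = Γ₀` real, the σ-part bound `θ_σ` and entrywise analyticity in `u` with the uniform localised majorant `θ₀`
give `‖R₃(σ)(b,b′)‖ ≤ (θ_σ + 2θ₀α/R)·e^{−κ|b₋−b′₋|₁}` for `R₃(σ) = Re G(σ, u) − Γ₀` (so that `Re G(σ, u) = Γ₀ + R₃(σ)`, the
identity `hdef3` there). [cite: Balaban1988RG2Cluster, (2.16) p.16, p.15] -/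
theorem h216R3_of_analytic {G : (ι → ℂ) → E → Matrix Λ C₀ ℂ} {Γ₀ : Matrix Λ C₀ ℝ} (Rσ : ι → ℝ)
    {R θ₀ θσ α κ : ℝ} (hR : 0 < R) (hθ₀ : 0 ≤ θ₀) (hαR : α < R) (locΛ : Λ → (Fin ν → ℤ))
    (locN : C₀ → (Fin ν → ℤ)) (hG0 : G 0 0 = Γ₀.map (algebraMap ℝ ℂ))
    (hσpart : ∀ σ : ι → ℂ, (∀ j, ‖σ j‖ ≤ Rσ j) →
      ∀ i j, ‖(G σ 0 - G 0 0) i j‖ ≤ θσ * Real.exp (-(κ * l1dist (locΛ i) (locN j))))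
    (ha : ∀ σ : ι → ℂ, (∀ j, ‖σ j‖ ≤ Rσ j) → ∀ i j, DifferentiableOn ℂ (fun u => G σ u i j) (ball 0 R))
    (hm : ∀ σ : ι → ℂ, (∀ j, ‖σ j‖ ≤ Rσ j) →
      ∀ u ∈ ball (0 : E) R, ∀ i j, ‖G σ u i j‖ ≤ θ₀ * Real.exp (-(κ * l1dist (locΛ i) (locN j))))
    {u : E} (hu : ‖u‖ ≤ α) :
    ∀ σ : ι → ℂ, (∀ j, ‖σ j‖ ≤ Rσ j) →
      ∀ i j, ‖((G σ u).map Complex.re - Γ₀) i j‖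
        ≤ (θσ + 2 * θ₀ * α / R) * Real.exp (-(κ * l1dist (locΛ i) (locN j))) := fun σ hσ i j => by
  have h := h216_split (A := G) σ 0 hR hθ₀ hαR locΛ locN (hσpart σ hσ) (ha σ hσ) (hm σ hσ) hu i j
  have hre : ((G σ u).map Complex.re - Γ₀) i j = ((G σ u - G 0 0) i j).re := by
    rw [hG0, Matrix.sub_apply, Matrix.sub_apply, Matrix.map_apply, Matrix.map_apply, Complex.sub_re,
      Complex.coe_algebraMap, Complex.ofReal_re]
  rw [hre, Real.norm_eq_abs]
  exact (Complex.abs_re_le_norm _).trans h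

end Split

end Literature.MathematicalPhysics.QuantumFieldTheory.Balaban1983to89.B13Eq216AnalyticStep

end
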